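import Summits.QuantumFields.YangMills.Theorems.BalabanUVNodesN19TargetOfDecorrelationReading

/-!
# YM-DAG node N19 (= NE7 proper) — THE DECORRELATION LETTER (DC) IN DUAL FORM: «the class-average of the two-run CONTRAST does not move when run A's
# class law is pushed from source `0` to source `t`», its TV × contrast-band price (why a law-separating EXTENSIVE contrast cannot be paid this way), and
# the exact covariance identity behind it

Cell `pub-ymgap`, HUMAN RULING D-0062 (Track A), width seat `pub-ymgap-dag-n19-w2` (node n19 = NE7), generation g7 (R455 (A) rule (ii); CLAIM-4 on the cell
bus).  Route `Summits/QuantumFields/YangMills/Theses/BalabanUVNodes.lean`, key item K3⁸ `SpineGivenEndpointR13SepCoPHV` (stmt-QuantumFields-27366; aside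
predecessor K3⁷ 20544); filed `--kind proof --supports … --as helper`.  COUNT-NEUTRAL.  THEOREMS ONLY (0 `def`, 0 `sorry`).  ADDITIVE — imports this seat's
FILE C `…N19TargetOfDecorrelationReading` (p625854) only; modifies nothing.

WHY.  FILE C's road reads node U5's `Target` from (RM) + (DC), (DC) being displayed as `|log(Σ_T B_0·A_t∕A_0) − log(Σ_T B_0) − (log Σ_T A_t − log Σ_T A_0)| ≤ κ`
— «the `ν_B`-mean and the `ν_A`-mean of run A's response agree».  Since `B_0·(A_t∕A_0) = A_t·(B_0∕A_0)`, the SAME expression is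
`log(Σ_T A_t·e^{h_0}) − log(Σ_T A_t) − (log(Σ_T A_0·e^{h_0}) − log(Σ_T A_0))` with `e^{h_0} = B_0∕A_0` the two-run source-free CONTRAST (§1, an identity): (DC)
says «the mean of the CONTRAST under run A's class law AT SOURCE `t` equals its mean under run A's class law AT SOURCE `0`, up to `e^{±κ}`» — the source
must not move the class-average of the two-run contrast.  This dual form prices (DC) by ONE run's class-law RESPONSE to the source against the contrast's
BAND (§2): if run A's class laws at `t` and `0` are `θ`-close in total variation and the contrast lies in a band `[m, M]`, then
`κ ≤ log(1 + θ(M − m)∕m)` — so a contrast band of width `O(1)` is paid by a summable law response `θ_K`, while an EXTENSIVE band (`M∕m = e^{n_K D_0}`, the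
window-key-core caricature) is NOT payable this way unless `θ_K` is exponentially small: there the aging∕conditional-blindness source of FILE D §4 is the
only road.  §3 records the exact normalised-covariance identity `E_{ν_A}[e^{h_0}ρ_t]∕(E[e^{h_0}]E[ρ_t]) − 1 = Cov_{ν_A}(e^{h_0}, ρ_t)∕(E[e^{h_0}]E[ρ_t])` in finite-sum
form, so that (DC) is literally «normalised covariance of contrast and response `≤ e^{κ} − 1`».

WHAT IS KERNEL-CHECKED ([folklore] finite sums).
* §1 `tiltedResponse_eq_tiltedContrast` (termwise `B_0·(A_t∕A_0) = A_t·(B_0∕A_0)`), ★ `decorrelation_eq_contrastMeanShift` (the (DC)-expression EQUALS the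
  source-shift of the class-mean of the contrast: `[log Σ A_t e^{h_0} − log Σ A_t] − [log Σ A_0 e^{h_0} − log Σ A_0]`).
* §2 `abs_weightedMean_sub_weightedMean_le_of_tv_of_band` (two probability vectors `p, q` on `T`, `½Σ|p − q| ≤ θ`, `f ∈ [m, M]` ⇒ `|Σ p f − Σ q f| ≤ θ(M − m)`),
  ★ `decorrelation_of_classLawTV_of_contrastBand` ((DC) with `κ = log(1 + θ(M − m)∕m)` from the TV-closeness `θ` of run A's normalised class laws at `t`
  and `0` and a contrast band `m ≤ B_0∕A_0 ≤ M`, `0 < m`).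
* §3 `decorrelationRatio_eq_one_add_normalisedCov` (the covariance identity, finite sums spelled out).

HONEST FRAMING.  Identities and elementary inequalities on hypothesis SHAPES (positive finite class weights); nothing of Bałaban's instantiated; (DC), the
TV-closeness `θ`, the band `[m, M]` are produced by nobody; NE7 NOT PRINTED for d = 4 ∕ NOT proved; N19 NOT discharged; K3⁸ 27366 OPEN, not claimed — K3's
stub 2 is typed on the `Core` road and NOT served here; counts UNMOVED (typed 28∕28 · discharged 5∕27, A 5∕28); no count claim.  One finite four-torus
programme at fixed ε; R4 closes the conditional finite-𝕋⁴ rung `BalabanLadder.UV` only — NOT the Yang–Mills mass gap, NOT the Clay problem.  0 `def`; 0 `sorry`.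
-/

noncomputable section

open Finset
open scoped BigOperators

namespace Summit.QuantumFields.YangMills.BalabanUVNodes.N19DecorrelationLetterDualForm

open Summit.QuantumFields.YangMills.BalabanUVNodes.N19TargetOfDecorrelationReading

variable {ι : Type*} {T : Finset ι} {A B : ℝ → ι → ℝ} {l₀ : ℝ}

/-! ## §1 The dual form: (DC) = the source does not move the class-average of the two-run contrast -/

/-- Termwise: `B_0·(A_t∕A_0) = A_t·(B_0∕A_0)` (`A_0 ≠ 0`). [folklore] -/
theorem tiltedResponse_eq_tiltedContrast {a0 a1 b0 : ℝ} (ha0 : a0 ≠ 0) : b0 * (a1 / a0) = a1 * (b0 / a0) := by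
  field_simp

/-- **THE DUAL FORM OF (DC).**  With positive run-A weights, the (DC)-expression of FILE C equals the SOURCE-SHIFT OF THE CLASS-MEAN OF THE CONTRAST
`e^{h_0} = B_0∕A_0`: `log(Σ_T B_0·A_t∕A_0) − log Σ_T B_0 − (log Σ_T A_t − log Σ_T A_0) = [log(Σ_T A_t·B_0∕A_0) − log Σ_T A_t] − [log(Σ_T A_0·B_0∕A_0) − log Σ_T A_0]`. [folklore] -/
theorem decorrelation_eq_contrastMeanShift (hA0 : ∀ τ ∈ T, 0 < A 0 τ) (t : ℝ) :
    Real.log (∑ τ ∈ T, B 0 τ * (A t τ / A 0 τ)) - Real.log (∑ τ ∈ T, B 0 τ) -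
        (Real.log (∑ τ ∈ T, A t τ) - Real.log (∑ τ ∈ T, A 0 τ)) =
      (Real.log (∑ τ ∈ T, A t τ * (B 0 τ / A 0 τ)) - Real.log (∑ τ ∈ T, A t τ)) -
        (Real.log (∑ τ ∈ T, A 0 τ * (B 0 τ / A 0 τ)) - Real.log (∑ τ ∈ T, A 0 τ)) := by
  have h1 : ∑ τ ∈ T, B 0 τ * (A t τ / A 0 τ) = ∑ τ ∈ T, A t τ * (B 0 τ / A 0 τ) :=
    Finset.sum_congr rfl fun τ hτ => tiltedResponse_eq_tiltedContrast (hA0 τ hτ).ne'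
  have h2 : ∑ τ ∈ T, A 0 τ * (B 0 τ / A 0 τ) = ∑ τ ∈ T, B 0 τ :=
    Finset.sum_congr rfl fun τ hτ => by have := (hA0 τ hτ).ne'; field_simp
  rw [h1, h2]; ring

/-! ## §2 The TV × band price of (DC) -/

/-- **WEIGHTED MEANS UNDER TV-CLOSE PROBABILITY VECTORS AND A BANDED FUNCTION.**  `p, q ≥ 0` on `T` with `Σ p = Σ q = 1`, `½·Σ_T |p − q| ≤ θ`, and
`m ≤ f ≤ M` on `T` ⇒ `|Σ_T p f − Σ_T q f| ≤ θ·(M − m)` (centre `f` at `(M+m)∕2`). [folklore] -/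
theorem abs_weightedMean_sub_weightedMean_le_of_tv_of_band {p q f : ι → ℝ} {θ m M : ℝ}
    (hp1 : ∑ τ ∈ T, p τ = 1) (hq1 : ∑ τ ∈ T, q τ = 1) (htv : (∑ τ ∈ T, |p τ - q τ|) / 2 ≤ θ)
    (hfm : ∀ τ ∈ T, m ≤ f τ) (hfM : ∀ τ ∈ T, f τ ≤ M) :
    |∑ τ ∈ T, p τ * f τ - ∑ τ ∈ T, q τ * f τ| ≤ θ * (M - m) := by
  -- centre `f`
  have hc : ∑ τ ∈ T, p τ * f τ - ∑ τ ∈ T, q τ * f τ = ∑ τ ∈ T, (p τ - q τ) * (f τ - (M + m) / 2) := by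
    have e1 : ∑ τ ∈ T, (p τ - q τ) * (f τ - (M + m) / 2) =
        ∑ τ ∈ T, (p τ * f τ - q τ * f τ) - ((M + m) / 2) * ∑ τ ∈ T, (p τ - q τ) := by
      rw [Finset.mul_sum, ← Finset.sum_sub_distrib]
      exact Finset.sum_congr rfl fun τ _ => by ring
    rw [e1, Finset.sum_sub_distrib, Finset.sum_sub_distrib, hp1, hq1]; ring
  rw [hc]
  have hband : ∀ τ ∈ T, |f τ - (M + m) / 2| ≤ (M - m) / 2 := fun τ hτ => by
    rw [abs_le]; constructor <;> linarith [hfm τ hτ, hfM τ hτ]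
  calc |∑ τ ∈ T, (p τ - q τ) * (f τ - (M + m) / 2)|
      ≤ ∑ τ ∈ T, |(p τ - q τ) * (f τ - (M + m) / 2)| := Finset.abs_sum_le_sum_abs _ _
    _ = ∑ τ ∈ T, |p τ - q τ| * |f τ - (M + m) / 2| := Finset.sum_congr rfl fun τ _ => abs_mul _ _
    _ ≤ ∑ τ ∈ T, |p τ - q τ| * ((M - m) / 2) :=
        Finset.sum_le_sum fun τ hτ => mul_le_mul_of_nonneg_left (hband τ hτ) (abs_nonneg _)
    _ = (∑ τ ∈ T, |p τ - q τ|) / 2 * (M - m) := by rw [← Finset.sum_mul]; ring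
    _ ≤ θ * (M - m) := by
        have hMm : 0 ≤ M - m := by
          obtain ⟨τ, hτ⟩ : T.Nonempty := by
            by_contra h
            rw [Finset.not_nonempty_iff_eq_empty] at h
            simp [h] at hp1
          linarith [hfm τ hτ, hfM τ hτ]
        exact mul_le_mul_of_nonneg_right htv hMm

/-- **(DC) FROM THE TV-CLOSENESS OF RUN A's CLASS LAWS AND A CONTRAST BAND** (the dual form priced).  Positive run-A weights; the normalised class laws
`ν^s := A_s∕Σ_T A_s` at `s = t` and `s = 0` are `θ`-close in total variation (`½Σ_T|ν^t − ν^0| ≤ θ`); the contrast is banded, `m ≤ B_0∕A_0 ≤ M` with `0 < m`;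
then (DC) holds with `κ = log(1 + θ(M − m)∕m)`.  READING: an `O(1)` contrast band is paid by a summable one-run class-law response `θ_K`; an EXTENSIVE band
(`M∕m = e^{n_K D_0}`) is not payable this way — FILE D §4's conditional blindness is then the road. [folklore] -/
theorem decorrelation_of_classLawTV_of_contrastBand (hT : T.Nonempty)
    (hA : ∀ s, |s| ≤ l₀ → ∀ τ ∈ T, 0 < A s τ) (hl₀ : 0 ≤ l₀) {θ m M : ℝ} (hm : 0 < m) (hθ : 0 ≤ θ)
    {t : ℝ} (ht : |t| ≤ l₀)
    (htv : (∑ τ ∈ T, |A t τ / (∑ σ ∈ T, A t σ) - A 0 τ / (∑ σ ∈ T, A 0 σ)|) / 2 ≤ θ)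
    (hbm : ∀ τ ∈ T, m ≤ B 0 τ / A 0 τ) (hbM : ∀ τ ∈ T, B 0 τ / A 0 τ ≤ M) :
    |Real.log (∑ τ ∈ T, B 0 τ * (A t τ / A 0 τ)) - Real.log (∑ τ ∈ T, B 0 τ) -
        (Real.log (∑ τ ∈ T, A t τ) - Real.log (∑ τ ∈ T, A 0 τ))| ≤ Real.log (1 + θ * (M - m) / m) := by
  have h0 : |(0 : ℝ)| ≤ l₀ := by simpa using hl₀
  rw [decorrelation_eq_contrastMeanShift (fun τ hτ => hA 0 h0 τ hτ) t]
  -- notation: totals and the two class-means of the contrast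
  have hSt : 0 < ∑ σ ∈ T, A t σ := Finset.sum_pos (fun τ hτ => hA t ht τ hτ) hT
  have hS0 : 0 < ∑ σ ∈ T, A 0 σ := Finset.sum_pos (fun τ hτ => hA 0 h0 τ hτ) hT
  set Et : ℝ := ∑ τ ∈ T, A t τ / (∑ σ ∈ T, A t σ) * (B 0 τ / A 0 τ) with hEt
  set E0 : ℝ := ∑ τ ∈ T, A 0 τ / (∑ σ ∈ T, A 0 σ) * (B 0 τ / A 0 τ) with hE0
  have hEt' : ∑ τ ∈ T, A t τ * (B 0 τ / A 0 τ) = (∑ σ ∈ T, A t σ) * Et := by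
    rw [hEt, Finset.mul_sum]
    exact Finset.sum_congr rfl fun τ _ => by have := hSt.ne'; field_simp
  have hE0' : ∑ τ ∈ T, A 0 τ * (B 0 τ / A 0 τ) = (∑ σ ∈ T, A 0 σ) * E0 := by
    rw [hE0, Finset.mul_sum]
    exact Finset.sum_congr rfl fun τ _ => by have := hS0.ne'; field_simp
  -- the means lie in the band, in particular are `≥ m > 0`
  have hp1 : ∑ τ ∈ T, A t τ / (∑ σ ∈ T, A t σ) = 1 := by rw [← Finset.sum_div, div_self hSt.ne']
  have hq1 : ∑ τ ∈ T, A 0 τ / (∑ σ ∈ T, A 0 σ) = 1 := by rw [← Finset.sum_div, div_self hS0.ne']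
  have hmean_ge : ∀ {w : ι → ℝ}, (∀ τ ∈ T, 0 ≤ w τ) → ∑ τ ∈ T, w τ = 1 → m ≤ ∑ τ ∈ T, w τ * (B 0 τ / A 0 τ) := by
    intro w hw hw1
    calc m = ∑ τ ∈ T, w τ * m := by rw [← Finset.sum_mul, hw1, one_mul]
      _ ≤ ∑ τ ∈ T, w τ * (B 0 τ / A 0 τ) := Finset.sum_le_sum fun τ hτ => mul_le_mul_of_nonneg_left (hbm τ hτ) (hw τ hτ)
  have hEtm : m ≤ Et := hmean_ge (fun τ hτ => (div_pos (hA t ht τ hτ) hSt).le) hp1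
  have hE0m : m ≤ E0 := hmean_ge (fun τ hτ => (div_pos (hA 0 h0 τ hτ) hS0).le) hq1
  have hEtpos : 0 < Et := lt_of_lt_of_le hm hEtm
  have hE0pos : 0 < E0 := lt_of_lt_of_le hm hE0m
  -- the TV × band bound on the difference of the means
  have hdiff : |Et - E0| ≤ θ * (M - m) :=
    abs_weightedMean_sub_weightedMean_le_of_tv_of_band hp1 hq1 htv hbm hbM
  -- rewrite the target as `|log Et − log E0|`
  rw [hEt', hE0', Real.log_mul hSt.ne' hEtpos.ne', Real.log_mul hS0.ne' hE0pos.ne']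
  have e : Real.log (∑ σ ∈ T, A t σ) + Real.log Et - Real.log (∑ σ ∈ T, A t σ) -
      (Real.log (∑ σ ∈ T, A 0 σ) + Real.log E0 - Real.log (∑ σ ∈ T, A 0 σ)) = Real.log Et - Real.log E0 := by ring
  rw [e]
  -- `|log Et − log E0| ≤ log(1 + θ(M−m)/m)`: both ratios `Et/E0`, `E0/Et` are `≤ 1 + θ(M−m)/m`
  have hMm : 0 ≤ M - m := by obtain ⟨τ, hτ⟩ := hT; linarith [hbm τ hτ, hbM τ hτ]
  have hD : 0 ≤ θ * (M - m) := mul_nonneg hθ hMm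
  have key : ∀ {x y : ℝ}, 0 < x → m ≤ y → |x - y| ≤ θ * (M - m) → Real.log x - Real.log y ≤ Real.log (1 + θ * (M - m) / m) := by
    intro x y hx hy hxy
    have hy0 : 0 < y := lt_of_lt_of_le hm hy
    rw [← Real.log_div hx.ne' hy0.ne']
    refine Real.log_le_log (div_pos hx hy0) ?_
    rw [div_le_iff₀ hy0]
    have h1 : x ≤ y + θ * (M - m) := by linarith [(abs_le.mp hxy).2]
    have h2 : θ * (M - m) ≤ θ * (M - m) / m * y := by
      rw [div_mul_eq_mul_div, le_div_iff₀ hm]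
      exact mul_le_mul_of_nonneg_left hy hD
    nlinarith [h1, h2]
  rw [abs_le]
  constructor
  · have := key hE0pos hEtm (by rw [abs_sub_comm]; exact hdiff)
    linarith
  · exact key hEtpos hE0m hdiff

/-! ## §3 The covariance identity behind (DC) -/

/-- **(DC)'s RATIO IS ONE PLUS THE NORMALISED COVARIANCE.**  For a probability vector `ν` on `T` and two functions `u` (the contrast) and `ρ` (the response) with
`Σ ν u ≠ 0`, `Σ ν ρ ≠ 0`: `Σ ν u ρ ∕ (Σ ν u · Σ ν ρ) = 1 + (Σ ν u ρ − Σ ν u · Σ ν ρ) ∕ (Σ ν u · Σ ν ρ)` — so FILE C's (DC) is literally a bound on the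
normalised covariance of contrast and response under run A's source-free class law. [folklore] -/
theorem decorrelationRatio_eq_one_add_normalisedCov {ν u ρ : ι → ℝ} (hu : ∑ τ ∈ T, ν τ * u τ ≠ 0) (hρ : ∑ τ ∈ T, ν τ * ρ τ ≠ 0) :
    (∑ τ ∈ T, ν τ * (u τ * ρ τ)) / ((∑ τ ∈ T, ν τ * u τ) * ∑ τ ∈ T, ν τ * ρ τ) =
      1 + ((∑ τ ∈ T, ν τ * (u τ * ρ τ)) - (∑ τ ∈ T, ν τ * u τ) * ∑ τ ∈ T, ν τ * ρ τ) /
        ((∑ τ ∈ T, ν τ * u τ) * ∑ τ ∈ T, ν τ * ρ τ) := by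
  have hne : (∑ τ ∈ T, ν τ * u τ) * ∑ τ ∈ T, ν τ * ρ τ ≠ 0 := mul_ne_zero hu hρ
  field_simp
  ring

end Summit.QuantumFields.YangMills.BalabanUVNodes.N19DecorrelationLetterDualForm

end
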